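import Summits.AtomisticToContinuum.FouriersLaw.Theorems.BondHeatUncertaintyExtensiveSnapshotIrreversibilityEnergyWindowPathBudget
import HarnessLib

/-!
# Bond heat uncertainty — energy window: the TIME DERIVATIVE of the Hessian along a driven path
  is `O(H)` pointwise and `O_θ(Θ_θ^{1/2})` in `L²` (rung (C2e) beneath the open leaf (COF))

Cell `decomp-a2c`, lens-1 «grading / quantitative ladder», generation 84, crux
`stmt-AtomisticToContinuum-9121` (`ExtensiveSnapshotIrreversibility`, K_fix half, leaf S3), part P
(imports part O `…EnergyWindowPathBudget` + HarnessLib).  The costate equation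
`α̇_j = Σ_i β_i ∂²Φ_{ij}(q_r)`, `β̇_i = -α_i + γ w_i β_i` has coefficients depending on the
POSITIONS of the driven path only; positions move at finite speed (`q̇ = p`, the first component
of the integral equation (IE)), so `r ↦ ∂²Φ_{ij}(q_r)` is `C¹` even though the momenta are not
differentiable.  This is what makes the path costate `C²` and feeds the Hölder-½ moduli of
`α̇_j` to the interpolation inequality (C2b) of part N via (C2c).  This file proves:

* `hasDerivAt_pinnedU_deriv_two`, `hasDerivAt_pinnedV_deriv_two` — the third derivatives
  `U''' = 6 lam q`, `V''' = 6 β r` of the `φ⁴` potentials (as `HasDerivAt` of `U''`, `V''`);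
* `hessDot` and `hasDerivAt_hessPotential_comp` — the derivative of `t ↦ ∂²Φ_{ij}(q(t))` along
  any curve with velocity `v` is the explicit tridiagonal form `hessDot(q, v)`;
* `abs_hessDot_le` — `|hessDot(q, p)| ≤ C_D · H(q, p)` with
  `C_D = 6 lam (1 + 1/ω₂) + 24 N² β` (energy coercivity: `ω₂ q_i² ≤ 2H`, `p_i² ≤ 2H`,
  `(q_{k+1} - q_k)² ≤ 2H`);
* `hasDerivAt_solMap_fst` — **positions are differentiable along every driven path**, with
  derivative the momenta, at every time `r > 0` (from the tree's integral equation
  `pinnedChain_isIntegralSolutionOn_chainFlow` and the FTC);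
* `hasDerivAt_hessPotential_solMap` — hence `r ↦ ∂²Φ_{ij}(q_r)` has derivative
  `hessDot(q_r, p_r)` at every `r > 0`, for EVERY noise path;
* `intervalIntegral_hessDot_sq_le` — `∫ₐᵇ hessDot(q_u, p_u)² du ≤ C_D² (2/θ²) Θ_θ` on every
  sub-window `[a, b] ⊆ [0, 1]`, every `θ > 0` (part O, second energy moment).

References: tree `LangevinChainSDE` (`pinnedChain_isIntegralSolutionOn_chainFlow`,
`pinnedChain_deriv_U`, `pinnedChain_U_le_hamiltonian`), `LangevinChainHormander`
(`hessPotential`, `pinnedChain_deriv_deriv_V`), `LangevinChainNESSProofs`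
(`pinnedChain_bond_le_hamiltonian`), `LangevinChainFlowBounds`
(`pinnedChain_sum_sq_le_two_mul_hamiltonian`), parts I-A, O.
-/

namespace Summit.AtomisticToContinuum.FouriersLaw.Theorems.ExtensiveSnapshotIrreversibility.EnergyWindow

open MeasureTheory Filter Topology Set Finset
open scoped Nat
open Literature.MathematicalPhysics.KineticTheory.HeatConduction Literature.Probability.Process

/-! ## 1. Third derivatives of the `φ⁴` potentials -/

/-- `U'' = ω₂ + 3 lam q²` as a function. [folklore] -/
theorem pinnedU_deriv_two_eq (ω₂ lam β γ : ℝ) :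
    deriv (deriv (pinnedChain ω₂ lam β γ).U) = fun a => ω₂ + 3 * lam * a ^ 2 := by
  have hd : deriv (pinnedChain ω₂ lam β γ).U = fun q => ω₂ * q + lam * q ^ 3 :=
    funext (pinnedChain_deriv_U ω₂ lam β γ)
  rw [hd]
  funext a
  have h := (hasDerivAt_const_mul ω₂ : HasDerivAt (fun y : ℝ => ω₂ * y) ω₂ a).fun_add
    ((hasDerivAt_pow 3 a).const_mul lam)
  rw [h.deriv]
  norm_num; ring

/-- `U''' = 6 lam q`: `HasDerivAt U'' (6 lam a) a`. [folklore] -/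
theorem hasDerivAt_pinnedU_deriv_two (ω₂ lam β γ a : ℝ) :
    HasDerivAt (deriv (deriv (pinnedChain ω₂ lam β γ).U)) (6 * lam * a) a := by
  rw [pinnedU_deriv_two_eq]
  have h := ((hasDerivAt_pow 2 a).const_mul (3 * lam)).const_add ω₂
  refine h.congr_deriv ?_
  norm_num; ring

/-- `V''' = 6 β r`: `HasDerivAt V'' (6 β r) r`. [folklore] -/
theorem hasDerivAt_pinnedV_deriv_two (ω₂ lam β γ r : ℝ) :
    HasDerivAt (deriv (deriv (pinnedChain ω₂ lam β γ).V)) (6 * β * r) r := by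
  have hV : deriv (deriv (pinnedChain ω₂ lam β γ).V) = fun r => 1 + 3 * β * r ^ 2 :=
    funext (pinnedChain_deriv_deriv_V ω₂ lam β γ)
  rw [hV]
  have h := ((hasDerivAt_pow 2 r).const_mul (3 * β)).const_add 1
  refine h.congr_deriv ?_
  norm_num; ring

/-! ## 2. The derivative of the Hessian along a curve -/

/-- The derivative of `t ↦ ∂²Φ_{ij}(q(t))` along a curve with velocity `v`:
`6 lam q_i v_i [i = j] + Σ_{l = k+1} 6β (q_l - q_k)(v_l - v_k) ([l = j] - [k = j])([l = i] - [k = i])`.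
[folklore] -/
def hessDot (lam β : ℝ) (N : ℕ) (i j : Fin N) (q v : Fin N → ℝ) : ℝ :=
  6 * lam * q i * v i * (if i = j then 1 else 0) +
    ∑ k : Fin N, ∑ l : Fin N, if l.val = k.val + 1 then
      6 * β * (q l - q k) * (v l - v k) * ((if l = j then 1 else 0) - (if k = j then 1 else 0)) *
        ((if l = i then 1 else 0) - (if k = i then 1 else 0)) else 0

/-- **Chain rule for the Hessian along a curve**: if every coordinate `t ↦ q(t)_k` has derivative
`v_k` at `r`, then `t ↦ ∂²Φ_{ij}(q(t))` has derivative `hessDot(q(r), v)` at `r`. [folklore] -/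
theorem hasDerivAt_hessPotential_comp (ω₂ lam β γ : ℝ) (N : ℕ) (i j : Fin N)
    {q : ℝ → Fin N → ℝ} {v : Fin N → ℝ} {r : ℝ} (hq : ∀ k, HasDerivAt (fun t => q t k) (v k) r) :
    HasDerivAt (fun t => (pinnedChain ω₂ lam β γ).hessPotential N i j (q t))
      (hessDot lam β N i j (q r) v) r := by
  unfold OscillatorChain.hessPotential hessDot
  refine HasDerivAt.add ?_ ?_
  · have h := ((hasDerivAt_pinnedU_deriv_two ω₂ lam β γ (q r i)).comp r (hq i)).mul_const
      (if i = j then (1 : ℝ) else 0)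
    exact h.congr_deriv (by ring)
  · refine HasDerivAt.fun_sum fun k _ => HasDerivAt.fun_sum fun l _ => ?_
    by_cases h : l.val = k.val + 1
    · simp only [h, if_true]
      have hd := (((hasDerivAt_pinnedV_deriv_two ω₂ lam β γ (q r l - q r k)).comp r
        ((hq l).sub (hq k))).mul_const
          ((if l = j then (1 : ℝ) else 0) - (if k = j then 1 else 0))).mul_const
          ((if l = i then (1 : ℝ) else 0) - (if k = i then 1 else 0))
      exact hd.congr_deriv (by ring)
    · simp only [h, if_false]
      exact hasDerivAt_const _ _

/-- `hessDot` is a continuous function on phase space (a polynomial in the coordinates).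
[folklore] -/
theorem continuous_hessDot (lam β : ℝ) (N : ℕ) (i j : Fin N) :
    Continuous fun x : PhaseSpace N => hessDot lam β N i j x.1 x.2 := by
  unfold hessDot
  have hq : ∀ m : Fin N, Continuous fun x : PhaseSpace N => x.1 m :=
    fun m => (continuous_apply m).comp continuous_fst
  have hp : ∀ m : Fin N, Continuous fun x : PhaseSpace N => x.2 m :=
    fun m => (continuous_apply m).comp continuous_snd
  refine ((((continuous_const.mul (hq i)).mul (hp i)).mul continuous_const)).add
    (continuous_finsetSum _ fun k _ => continuous_finsetSum _ fun l _ => ?_)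
  by_cases h : l.val = k.val + 1
  · simp only [h, if_true]
    exact ((((continuous_const.mul ((hq l).sub (hq k))).mul ((hp l).sub (hp k))).mul
      continuous_const).mul continuous_const)
  · simp only [h, if_false]
    exact continuous_const

/-! ## 3. The pointwise energy bound of `hessDot(q, p)` -/

section Bound

variable {ω₂ lam β γ : ℝ} (hω : 0 < ω₂) (hl : 0 ≤ lam) (hβ : 0 ≤ β) (N : ℕ)

include hω hl hβ in
/-- **`|hessDot(q, p)| ≤ C_D H(q, p)`** with `C_D = 6 lam (1 + 1/ω₂) + 24 N² β`: the Hessian of the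
`φ⁴` chain moves at a speed controlled by the energy. [NEW · rung (C2e) beneath (COF)] -/
theorem abs_hessDot_le (x : PhaseSpace N) (i j : Fin N) :
    |hessDot lam β N i j x.1 x.2| ≤
      (6 * lam * (1 + 1 / ω₂) + (N : ℝ) * N * (24 * β)) *
        (pinnedChain ω₂ lam β γ).hamiltonian N x := by
  set H := (pinnedChain ω₂ lam β γ).hamiltonian N x with hH
  have hH0 : 0 ≤ H := pinnedChain_hamiltonian_nonneg hω.le hl hβ γ N x
  -- energy coercivity
  have hp2 : ∀ m : Fin N, x.2 m ^ 2 ≤ 2 * H := fun m =>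
    (Finset.single_le_sum (f := fun m => x.2 m ^ 2) (fun m _ => sq_nonneg _)
      (Finset.mem_univ m)).trans (pinnedChain_sum_sq_le_two_mul_hamiltonian hω hl hβ N x)
  have hq2 : x.1 i ^ 2 ≤ 2 * H / ω₂ := by
    have h := pinnedChain_U_le_hamiltonian hω.le hl hβ γ N x i
    rw [le_div_iff₀ hω]
    nlinarith [mul_nonneg hl (pow_nonneg (sq_nonneg (x.1 i)) 2), pow_two (x.1 i ^ 2)]
  have hbond : ∀ k l : Fin N, l.val = k.val + 1 → (x.1 l - x.1 k) ^ 2 ≤ 2 * H := by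
    intro k l hlk
    have h := pinnedChain_bond_le_hamiltonian hω.le hl hβ γ N x hlk
    nlinarith [mul_nonneg hβ (pow_nonneg (sq_nonneg (x.1 l - x.1 k)) 2),
      pow_two ((x.1 l - x.1 k) ^ 2)]
  have hind : ∀ (p q : Prop) [Decidable p] [Decidable q],
      |((if p then (1 : ℝ) else 0) - (if q then 1 else 0))| ≤ 1 := by
    intro p q _ _; split_ifs <;> norm_num
  -- pinning term
  have h1 : |6 * lam * x.1 i * x.2 i * (if i = j then (1 : ℝ) else 0)| ≤
      6 * lam * (1 + 1 / ω₂) * H := by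
    have hι : |(if i = j then (1 : ℝ) else 0)| ≤ 1 := by split_ifs <;> norm_num
    have hqp : 2 * (|x.1 i| * |x.2 i|) ≤ x.1 i ^ 2 + x.2 i ^ 2 := by
      nlinarith [sq_nonneg (|x.1 i| - |x.2 i|), sq_abs (x.1 i), sq_abs (x.2 i)]
    have hqp' : |x.1 i| * |x.2 i| ≤ (1 + 1 / ω₂) * H := by
      have : x.1 i ^ 2 + x.2 i ^ 2 ≤ 2 * H / ω₂ + 2 * H := add_le_add hq2 (hp2 i)
      have h3 : 2 * H / ω₂ + 2 * H = 2 * ((1 + 1 / ω₂) * H) := by ring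
      linarith
    calc |6 * lam * x.1 i * x.2 i * (if i = j then (1 : ℝ) else 0)|
        = 6 * lam * (|x.1 i| * |x.2 i|) * |(if i = j then (1 : ℝ) else 0)| := by
          rw [abs_mul, abs_mul, abs_mul, abs_mul, abs_of_nonneg (by norm_num : (0:ℝ) ≤ 6),
            abs_of_nonneg hl]; ring
      _ ≤ 6 * lam * ((1 + 1 / ω₂) * H) * 1 := by gcongr
      _ = 6 * lam * (1 + 1 / ω₂) * H := by ring
  -- bond terms
  have h2 : ∀ k l : Fin N,
      |(if l.val = k.val + 1 then
          6 * β * (x.1 l - x.1 k) * (x.2 l - x.2 k) *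
            ((if l = j then 1 else 0) - (if k = j then 1 else 0)) *
            ((if l = i then 1 else 0) - (if k = i then 1 else 0)) else (0 : ℝ))| ≤ 24 * β * H := by
    intro k l
    have hc : (0 : ℝ) ≤ 24 * β * H := by positivity
    by_cases hlk : l.val = k.val + 1
    · rw [if_pos hlk]
      have hb := hbond k l hlk
      have hprod : |x.1 l - x.1 k| * |x.2 l - x.2 k| ≤ 4 * H := by
        have ht : |x.2 l - x.2 k| ≤ |x.2 l| + |x.2 k| := abs_sub _ _
        have e1 : 2 * (|x.1 l - x.1 k| * |x.2 l|) ≤ (x.1 l - x.1 k) ^ 2 + x.2 l ^ 2 := by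
          nlinarith [sq_nonneg (|x.1 l - x.1 k| - |x.2 l|), sq_abs (x.1 l - x.1 k), sq_abs (x.2 l)]
        have e2 : 2 * (|x.1 l - x.1 k| * |x.2 k|) ≤ (x.1 l - x.1 k) ^ 2 + x.2 k ^ 2 := by
          nlinarith [sq_nonneg (|x.1 l - x.1 k| - |x.2 k|), sq_abs (x.1 l - x.1 k), sq_abs (x.2 k)]
        nlinarith [mul_le_mul_of_nonneg_left ht (abs_nonneg (x.1 l - x.1 k)), hp2 l, hp2 k, hb]
      have ha := hind (l = j) (k = j)
      have hb' := hind (l = i) (k = i)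
      calc |6 * β * (x.1 l - x.1 k) * (x.2 l - x.2 k) *
              ((if l = j then 1 else 0) - (if k = j then 1 else 0)) *
              ((if l = i then 1 else 0) - (if k = i then 1 else 0))|
          = 6 * β * (|x.1 l - x.1 k| * |x.2 l - x.2 k|) *
              |((if l = j then (1 : ℝ) else 0) - (if k = j then 1 else 0))| *
              |((if l = i then (1 : ℝ) else 0) - (if k = i then 1 else 0))| := by
            rw [abs_mul, abs_mul, abs_mul, abs_mul, abs_mul,
              abs_of_nonneg (by norm_num : (0:ℝ) ≤ 6), abs_of_nonneg hβ]; ring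
        _ ≤ 6 * β * (4 * H) * 1 * 1 := by gcongr
        _ = 24 * β * H := by ring
    · rw [if_neg hlk, abs_zero]; exact hc
  -- assemble
  unfold hessDot
  refine (abs_add_le _ _).trans ?_
  have hsum : |∑ k : Fin N, ∑ l : Fin N, (if l.val = k.val + 1 then
      6 * β * (x.1 l - x.1 k) * (x.2 l - x.2 k) *
        ((if l = j then 1 else 0) - (if k = j then 1 else 0)) *
        ((if l = i then 1 else 0) - (if k = i then 1 else 0)) else (0 : ℝ))| ≤
      (N : ℝ) * ((N : ℝ) * (24 * β * H)) := by
    refine (Finset.abs_sum_le_sum_abs _ _).trans ?_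
    calc ∑ k : Fin N, |∑ l : Fin N, (if l.val = k.val + 1 then
            6 * β * (x.1 l - x.1 k) * (x.2 l - x.2 k) *
              ((if l = j then 1 else 0) - (if k = j then 1 else 0)) *
              ((if l = i then 1 else 0) - (if k = i then 1 else 0)) else (0 : ℝ))|
        ≤ ∑ k : Fin N, ∑ l : Fin N, (24 * β * H) :=
          Finset.sum_le_sum fun k _ =>
            (Finset.abs_sum_le_sum_abs _ _).trans (Finset.sum_le_sum fun l _ => h2 k l)
      _ = (N : ℝ) * ((N : ℝ) * (24 * β * H)) := by
          simp only [Finset.sum_const, Finset.card_univ, Fintype.card_fin, nsmul_eq_mul]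
  refine (add_le_add h1 hsum).trans (le_of_eq ?_)
  ring

end Bound

/-! ## 4. Positions are differentiable along every driven path -/

section Path

variable {ω₂ lam β γ : ℝ} (hω : 0 < ω₂) (hl : 0 ≤ lam) (hβ : 0 ≤ β) (hγ : 0 ≤ γ) (N : ℕ)
  (T_L T_R : ℝ)

include hω hl hβ hγ in
/-- **`q̇ = p` along every driven path**: for `r > 0` and every noise path, the position
coordinate `t ↦ q_k(Φ_t(z, B(wp)))` has derivative `p_k(Φ_r(z, B(wp)))` at `r` (first component
of the integral equation (IE) and the FTC; the momenta are merely continuous). [folklore] -/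
theorem hasDerivAt_solMap_fst (z : PhaseSpace N) (wp : WienerPair) {r : ℝ} (hr : 0 < r)
    (k : Fin N) :
    HasDerivAt (fun t => ((pinnedChain ω₂ lam β γ).solMap N T_L T_R t z (pairPath wp)).1 k)
      (((pinnedChain ω₂ lam β γ).solMap N T_L T_R r z (pairPath wp)).2 k) r := by
  set P := pinnedChain ω₂ lam β γ with hP
  set η := chainNoise N (Real.sqrt (2 * P.γ * T_L)) (Real.sqrt (2 * P.γ * T_R)) (pairPath wp)
    with hη
  have hηc : Continuous η := continuous_chainNoise _ _ _
  set ζ : ℝ → PhaseSpace N := fun t => P.solMap N T_L T_R t z (pairPath wp) with hζ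
  have hζeq : ζ = P.chainFlow N z η := rfl
  have hζc : Continuous ζ := pinnedChain_continuous_solMap hω hl hβ hγ N T_L T_R z (pairPath wp)
  -- the integral equation on `[0, r + 1]`
  have hIE := pinnedChain_isIntegralSolutionOn_chainFlow hω hl hβ hγ N z hηc (r + 1)
  -- continuity of the drift along the path and of the momentum coordinate
  have hYc : Continuous fun s => P.drift N (ζ s) :=
    (pinnedChain_contDiff_drift ω₂ lam β γ N (n := 0)).continuous.comp hζc
  have hpc : Continuous fun s => (ζ s).2 k := (continuous_apply k).comp (continuous_snd.comp hζc)
  -- the coordinate functional `y ↦ y.1 k`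
  set L : PhaseSpace N →L[ℝ] ℝ :=
    (ContinuousLinearMap.proj k).comp (ContinuousLinearMap.fst ℝ (Fin N → ℝ) (Fin N → ℝ)) with hL
  have hLy : ∀ y : PhaseSpace N, L y = y.1 k := fun y => rfl
  -- the position coordinate as an integral of the momentum coordinate
  have hrepr : ∀ t ∈ Icc 0 (r + 1), (ζ t).1 k = z.1 k + ∫ s in (0 : ℝ)..t, (ζ s).2 k := by
    intro t ht
    have h := hIE t ht
    rw [← hζeq] at h
    have h1 : (ζ t).1 k = L (ζ t) := (hLy _).symm
    rw [h1, h, map_add, ← L.intervalIntegral_comp_comm (hYc.intervalIntegrable _ _)]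
    have h2 : L (OscillatorChain.forcing z η t) = z.1 k := by
      rw [hLy]; simp [OscillatorChain.forcing]
    rw [h2]
    congr 1
  -- FTC for the momentum integral
  have hF : HasDerivAt (fun t => z.1 k + ∫ s in (0 : ℝ)..t, (ζ s).2 k) ((ζ r).2 k) r :=
    (intervalIntegral.integral_hasDerivAt_right (hpc.intervalIntegrable _ _)
      (hpc.stronglyMeasurableAtFilter _ _) hpc.continuousAt).const_add _
  refine hF.congr_of_eventuallyEq ?_
  have hnhds : Ioo 0 (r + 1) ∈ 𝓝 r := Ioo_mem_nhds hr (by linarith)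
  filter_upwards [hnhds] with t ht
  exact hrepr t (Ioo_subset_Icc_self ht)

include hω hl hβ hγ in
/-- **The Hessian along a driven path is `C¹`**: for `r > 0` and every noise path,
`t ↦ ∂²Φ_{ij}(q_t)` has derivative `hessDot(q_r, p_r)` at `r`. [NEW · rung (C2e) beneath (COF)] -/
theorem hasDerivAt_hessPotential_solMap (z : PhaseSpace N) (wp : WienerPair) {r : ℝ} (hr : 0 < r)
    (i j : Fin N) :
    HasDerivAt (fun t => (pinnedChain ω₂ lam β γ).hessPotential N i j
        ((pinnedChain ω₂ lam β γ).solMap N T_L T_R t z (pairPath wp)).1)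
      (hessDot lam β N i j ((pinnedChain ω₂ lam β γ).solMap N T_L T_R r z (pairPath wp)).1
        ((pinnedChain ω₂ lam β γ).solMap N T_L T_R r z (pairPath wp)).2) r :=
  hasDerivAt_hessPotential_comp ω₂ lam β γ N i j
    (q := fun t => ((pinnedChain ω₂ lam β γ).solMap N T_L T_R t z (pairPath wp)).1)
    fun k => hasDerivAt_solMap_fst hω hl hβ hγ N T_L T_R z wp hr k

include hω hl hβ hγ in
/-- **The speed of the Hessian along a driven path is `O_θ(Θ_θ^{1/2})` in `L²`**: for `θ > 0`
and a sub-window `0 ≤ a ≤ b ≤ 1`, `∫ₐᵇ hessDot(q_u, p_u)² du ≤ C_D² · (2/θ²) · Θ_θ`.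
[NEW · rung (C2e) beneath (COF)] -/
theorem intervalIntegral_hessDot_sq_le {θ : ℝ} (hθ : 0 < θ) (i j : Fin N) (z : PhaseSpace N)
    (wp : WienerPair) {a b : ℝ} (h0a : 0 ≤ a) (hab : a ≤ b) (hb1 : b ≤ 1) :
    ∫ u in a..b, (hessDot lam β N i j
        ((pinnedChain ω₂ lam β γ).solMap N T_L T_R u z (pairPath wp)).1
        ((pinnedChain ω₂ lam β γ).solMap N T_L T_R u z (pairPath wp)).2) ^ 2 ≤
      (6 * lam * (1 + 1 / ω₂) + (N : ℝ) * N * (24 * β)) ^ 2 * ((2 : ℝ) / θ ^ 2) *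
        energyBudget ω₂ lam β γ N T_L T_R θ z wp := by
  set P := pinnedChain ω₂ lam β γ with hP
  set C := 6 * lam * (1 + 1 / ω₂) + (N : ℝ) * N * (24 * β) with hC
  set Hp := pathEnergy ω₂ lam β γ N T_L T_R z wp with hHp
  have hC0 : 0 ≤ C := by positivity
  have hζc := pinnedChain_continuous_solMap hω hl hβ hγ N T_L T_R z (pairPath wp)
  have hcont : Continuous fun u => (hessDot lam β N i j (P.solMap N T_L T_R u z (pairPath wp)).1
      (P.solMap N T_L T_R u z (pairPath wp)).2) ^ 2 :=
    ((continuous_hessDot lam β N i j).comp hζc).pow 2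
  have hHc : Continuous Hp := continuous_pathEnergy hω hl hβ hγ z wp
  -- pointwise: `hessDot² ≤ C² H²`
  have hpt : ∀ u, (hessDot lam β N i j (P.solMap N T_L T_R u z (pairPath wp)).1
      (P.solMap N T_L T_R u z (pairPath wp)).2) ^ 2 ≤ C ^ 2 * Hp u ^ 2 := by
    intro u
    have h := abs_hessDot_le (γ := γ) hω hl hβ N (P.solMap N T_L T_R u z (pairPath wp)) i j
    have hH0 : 0 ≤ Hp u := pathEnergy_nonneg hω.le hl hβ z wp u
    have h2 := pow_le_pow_left₀ (abs_nonneg _) h 2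
    rw [sq_abs] at h2
    calc _ ≤ (C * Hp u) ^ 2 := h2
      _ = C ^ 2 * Hp u ^ 2 := by ring
  have hI2 : ∫ u in a..b, Hp u ^ 2 ≤ (2 ! : ℝ) / θ ^ 2 * energyBudget ω₂ lam β γ N T_L T_R θ z wp :=
    intervalIntegral_pathEnergy_pow_le hω hl hβ hγ N hθ 2 z wp h0a hab hb1
  have h2f : ((2 ! : ℕ) : ℝ) = 2 := by norm_num
  calc ∫ u in a..b, (hessDot lam β N i j (P.solMap N T_L T_R u z (pairPath wp)).1
          (P.solMap N T_L T_R u z (pairPath wp)).2) ^ 2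
      ≤ ∫ u in a..b, C ^ 2 * Hp u ^ 2 :=
        intervalIntegral.integral_mono_on hab (hcont.intervalIntegrable _ _)
          ((continuous_const.mul (hHc.pow 2)).intervalIntegrable _ _) fun u _ => hpt u
    _ = C ^ 2 * ∫ u in a..b, Hp u ^ 2 := intervalIntegral.integral_const_mul _ _
    _ ≤ C ^ 2 * ((2 : ℝ) / θ ^ 2 * energyBudget ω₂ lam β γ N T_L T_R θ z wp) := by
        refine mul_le_mul_of_nonneg_left ?_ (by positivity)
        rw [h2f] at hI2
        exact hI2
    _ = C ^ 2 * ((2 : ℝ) / θ ^ 2) * energyBudget ω₂ lam β γ N T_L T_R θ z wp := by ring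

end Path

end Summit.AtomisticToContinuum.FouriersLaw.Theorems.ExtensiveSnapshotIrreversibility.EnergyWindow
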